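import Summits.HodgeConjecture.HodgeConjecture.Theorems.SoloBlindKummerH2Lat

/-!
# SoloBlindSixfoldCensus — arithmetic of the coprime direction of door H (s21)

Solo-blind residency on the Hodge conjecture, door H (twistor transport of a rational Hodge
similarity of multiplier `d = 2` between Kummer surfaces), coprime ("twisted") direction.
Companion text: `paper/k3-weil-faces.md` §2.8.8–2.8.9 of the residency folder; claims SB-C127 ff.

Informal setting (NOT formalised).  A hyperholomorphic anchor `F` of rank `2` on `Km B × Km A` with
`ch₂(F)^{(2,2)} = −m[ψ̃]` and `c₁(F) = pr₂^*ξ′`, `ξ′ ∉ 2H²`, gives a compact immersed K3 surface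
`Σ′ ≅ Km B` in a hyperkähler manifold `M′` of `K3^[n′]`-type, `n′ = ξ′²/2 + 1 − 2a′`, with
`⟨q^∨, [Σ′]⟩ = 22k`, `k = m²d = 2m²`.  Three necessary conditions are derived in the companion text:
* (Prop. F, `n′ = 3`)  `c₂(M′) = (4/3)·q^∨` for `K3^[3]`-type, so `88k/3 − 24 = c₂(N_{Σ′}) ∈ ℤ`, forcing `3 ∣ k`;
* (Prop. G = EA6)  `m·ψ̃ᵗ(ξ′) ∈ 2H²(Km B, ℤ)`; for odd `m`, `ξ′ = ψ̃(λ)` with `λ` in the (even) K3 lattice,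
  hence `ξ′² = 2λ² ≡ 0 (mod 4)` and `n′` is odd (parity lemma);
* (Prop. E, `n′ = 2`, s20)  `10 ∣ k` and `k ≥ 20`.
What this file certifies in the kernel:
* §A the integer arithmetic: `3c = 88k − 72 → 3 ∣ k`, `3 ∣ 2m² → 3 ∣ m`, the parity lemma, and the
  conclusion that `m = ±1` (`k = 2`) needs `n′ ≥ 5` (a twisted ambient of dimension `≥ 10`);
* §B by `decide` on the explicit `H2-lat` solutions of `SoloBlindKummerH2Lat` (`ρ = ±1`): the node
  coordinates `c = ¼·Wᵗ·w` of `ψ̃ᵗ(ξ′)` for their first Chern class `ξ′ = U′ − κ_A = ½Σⱼ wⱼN′ⱼ`,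
  `w = Σₖ a′ₖ − 𝟙`, are integers whose reduction mod 2 has weight `12`, hence is NOT a codeword of
  `RM(1,4)`: `ψ̃ᵗ(ξ′) ∉ 2H²(Km B, ℤ)`, i.e. these classes violate EA6 for `m = 1` (while the base class
  `ξ′₀ = −κ_A`, `w = −𝟙`, satisfies it);
* §C the pattern lemma behind Cor. 3 of §2.8.9: choosing one node out of each of the 8 node pairs
  `{x, x + e₄}` according to `g : 𝔽₂³ → 𝔽₂` gives an `RM(1,4)` codeword iff `g` is affine (exhaustive
  over the `256` functions `g`).
The geometric derivations (GRR for `θ_F`, `κ′^*u′ = 0`, the LLV decomposition of `H⁴(K3^[3])`,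
O'Grady's `c₂ = (4/3)q^∨`) are prose in the companion text and are NOT asserted here.
-/

namespace Summit.HodgeConjecture.HodgeConjecture.Theorems
namespace SixfoldCensus

open KummerH2Lat

/-! ## §A  Integer arithmetic of the census -/

/-- `α₃ = ∫c₂β⁴ / ∫q^∨β⁴ = 108/81 = 4/3` (and the fourfold value `30/25 = 6/5` of Prop. E). -/
theorem alpha_three : (108 : ℚ) / 81 = 4 / 3 ∧ (30 : ℚ) / 25 = 6 / 5 := by norm_num

/-- `⟨c₂(M′),[Σ′]⟩ = (4/3)·22k = 88k/3` for `n′ = 3`. -/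
theorem pairing_three (k : ℚ) : (4 / 3 : ℚ) * (22 * k) = 88 * k / 3 := by ring

/-- Prop. F (core): if `c₂(N′) = 88k/3 − 24` is an integer `c`, then `3 ∣ k`. -/
theorem three_dvd_of_sixfold (k c : ℤ) (h : 3 * c = 88 * k - 72) : (3 : ℤ) ∣ k := by omega

/-- With `k = m²d`, `d = 2`: `3 ∣ 2m² → 3 ∣ m`. -/
theorem three_dvd_m (m : ℤ) (h : (3 : ℤ) ∣ 2 * m ^ 2) : (3 : ℤ) ∣ m := by
  have h3 : Prime (3 : ℤ) := Int.prime_three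
  rcases h3.dvd_or_dvd h with h2 | hm
  · exact absurd h2 (by decide)
  · exact h3.dvd_of_dvd_pow hm

/-- Prop. F for `d = 2`: a sixfold twisted ambient forces `3 ∣ m`. -/
theorem sixfold_needs_three_dvd_m (m c : ℤ) (h : 3 * c = 88 * (2 * m ^ 2) - 72) : (3 : ℤ) ∣ m :=
  three_dvd_m m (three_dvd_of_sixfold (2 * m ^ 2) c h)

/-- Parity lemma: if `ξ′² = 2λ²` with `λ² = 2e` even (an even lattice), then
`n′ = ξ′²/2 + 1 − 2a′ = 2e + 1 − 2a′` is odd. -/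
theorem nprime_odd (e a : ℤ) : Odd (2 * e + 1 - 2 * a) := ⟨e - a, by ring⟩

/-- The case `m = ±1` (`k = 2`): an odd `n′ ≥ 2` with `n′ = 3 → 3 ∣ 2` satisfies `n′ ≥ 5`
(twisted ambient of dimension `≥ 10`). -/
theorem m_one_needs_nprime_ge_five (n : ℕ) (hn : 2 ≤ n) (hodd : Odd n)
    (h3 : n = 3 → (3 : ℤ) ∣ 2 * 1 ^ 2) : 5 ≤ n := by
  have hno : ¬ (3 : ℤ) ∣ 2 * 1 ^ 2 := by decide
  have hne : n ≠ 3 := fun h => hno (h3 h)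
  rcases hodd with ⟨j, rfl⟩
  omega

/-- The case `m = ±2` (`k = 8`): `n′ = 2 → 10 ∣ 8` and `n′ = 3 → 3 ∣ 8` force `n′ ≥ 4`. -/
theorem m_two_needs_nprime_ge_four (n : ℕ) (hn : 2 ≤ n)
    (h2 : n = 2 → (10 : ℤ) ∣ 8) (h3 : n = 3 → (3 : ℤ) ∣ 8) : 4 ≤ n := by
  have a : ¬ (10 : ℤ) ∣ 8 := by decide
  have b : ¬ (3 : ℤ) ∣ 8 := by decide
  have hne2 : n ≠ 2 := fun h => a (h2 h)
  have hne3 : n ≠ 3 := fun h => b (h3 h)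
  omega

/-- A fourfold twisted ambient (`n′ = 2`, hence `m` even by the parity lemma, and `10 ∣ 2m²`
by Prop. E) forces `10 ∣ m`. -/
theorem fourfold_needs_ten_dvd_m (m : ℤ) (heven : Even m) (h : (10 : ℤ) ∣ 2 * m ^ 2) :
    (10 : ℤ) ∣ m := by
  have h5 : (5 : ℤ) ∣ m := by
    have p5 : Prime (5 : ℤ) := by norm_num
    have : (5 : ℤ) ∣ 2 * m ^ 2 := dvd_trans (by norm_num) h
    rcases p5.dvd_or_dvd this with h2 | hm
    · exact absurd h2 (by decide)
    · exact p5.dvd_of_dvd_pow hm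
  rcases heven with ⟨t, rfl⟩
  omega

/-! ## §B  EA6 on the explicit `H2-lat` solutions -/

/-- Convention checks for `%` (Euclidean) and exact `/` on `ℤ` as used below. -/
theorem conventions : (-3 : ℤ) % 2 = 1 ∧ (-21 : ℤ) % 2 = 1 ∧ (-8 : ℤ) / 4 = -2 ∧ (-84 : ℤ) % 4 = 0 := by
  decide

/-- `w = Σₖ a′ₖ − 𝟙`: node coordinates of `2ξ′`, `ξ′ = U′ − κ_A = ½ Σⱼ wⱼ N′ⱼ`. -/
def wOf (ps : List (List ℤ × List ℤ)) : List ℤ :=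
  idx.map fun j => (ps.map fun p => ent p.2 j).sum - 1

/-- `Wᵗ·v` (row `i` ↔ node of `Km B`, column `j` ↔ node of `Km A`). -/
def WtMul (v : List ℤ) : List ℤ := idx.map fun i => (idx.map fun j => ent2 Wt i j * ent v j).sum

/-- `c = ¼ Wᵗ·w`: node coordinates of `ψ̃ᵗ(ξ′) = Σᵢ cᵢ Nᵢ` (exact division, see `*_div4`). -/
def cOf (ps : List (List ℤ × List ℤ)) : List ℤ := (WtMul (wOf ps)).map fun x => x / 4

/-- Hamming weight of `v mod 2`. -/
def wt2 (v : List ℤ) : ℤ := (v.map fun x => x % 2).sum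

set_option maxHeartbeats 4000000 in
/-- `ρ = 1`: `Wᵗ·w ≡ 0 (mod 4)` entrywise, so `c = ¼Wᵗw` is integral. -/
theorem pairsP_div4 : ((WtMul (wOf pairsP)).all fun x => x % 4 == 0) = true := by decide

set_option maxHeartbeats 4000000 in
/-- `ρ = 1`: `c mod 2` has weight `12 ∉ {0, 8, 16}` … -/
theorem pairsP_weight : wt2 (cOf pairsP) = 12 := by decide

set_option maxHeartbeats 4000000 in
/-- … hence is not an `RM(1,4)` codeword: `ψ̃ᵗ(ξ′) ∉ 2H²(Km B,ℤ)`, EA6 fails for `m = 1`. -/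
theorem pairsP_not_RM : isRM (cOf pairsP) = false := by decide

set_option maxHeartbeats 4000000 in
/-- `ρ = −1`: integrality of `c`. -/
theorem pairsM_div4 : ((WtMul (wOf pairsM)).all fun x => x % 4 == 0) = true := by decide

set_option maxHeartbeats 4000000 in
/-- `ρ = −1`: weight `12`. -/
theorem pairsM_weight : wt2 (cOf pairsM) = 12 := by decide

set_option maxHeartbeats 4000000 in
/-- `ρ = −1`: EA6 fails for `m = 1`. -/
theorem pairsM_not_RM : isRM (cOf pairsM) = false := by decide

/-- For even `m` EA6 is automatic: `2c mod 2 = 0` is the zero codeword (here for `ρ = 1`). -/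
theorem pairsP_even_m : isRM ((cOf pairsP).map fun x => 2 * x) = true := by decide

/-- Control: the base class `ξ′₀ = −κ_A` (`w = −𝟙`) satisfies EA6: `c = −¼Wᵗ𝟙` reduces to the
weight-8 codeword `{x : x₀ = 0}`. -/
theorem control_base_RM :
    isRM ((WtMul (idx.map fun _ => (-1 : ℤ))).map fun x => x / 4) = true := by decide

/-! ## §C  The pair-pattern lemma (Cor. 3 of §2.8.9) -/

/-- Choosing from each node pair `{2t, 2t+1}` (`t ∈ 𝔽₂³` = bits 3,2,1; the pair is `{x, x + e₄}`,
`e₄` = bit 0) the element with bit 0 equal to `g(t)`, `g` encoded by the 8-bit mask `G`. -/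
def graphOf (G : ℕ) : List ℤ := idx.map fun x => if (G.testBit (x / 2)) = (x % 2 == 1) then 1 else 0

/-- The 16 affine functions `𝔽₂³ → 𝔽₂` as 8-bit masks (`RM(1,3)`). -/
def rm13 : List ℕ :=
  (List.range 16).map fun c => (List.range 8).foldr (fun t acc =>
    2 * acc + (((c.testBit 3).toNat + (c.testBit 2 && t.testBit 2).toNat +
      (c.testBit 1 && t.testBit 1).toNat + (c.testBit 0 && t.testBit 0).toNat) % 2)) 0

/-- `rm13` lists 16 distinct masks. -/
theorem rm13_card : rm13.length = 16 ∧ rm13.Nodup := by decide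

/-- `isRM (graphOf G)` agrees with `G ∈ rm13` for all masks `G` in `[lo, lo + len)`. -/
def graphCheck (lo len : ℕ) : Bool :=
  ((List.range len).map fun i => lo + i).all fun G => isRM (graphOf G) == rm13.contains G

set_option maxRecDepth 100000 in
set_option maxHeartbeats 4000000 in
/-- The graph `{(t, g t)}` of `g : 𝔽₂³ → 𝔽₂` is (the support of) an `RM(1,4)` codeword iff `g` is
affine: exhaustive check over all `256` functions `g` (in four blocks of `64`). -/
theorem graph_codeword_iff_affine :
    graphCheck 0 64 = true ∧ graphCheck 64 64 = true ∧ graphCheck 128 64 = true ∧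
      graphCheck 192 64 = true := by
  refine ⟨?_, ?_, ?_, ?_⟩ <;> decide

end SixfoldCensus
end Summit.HodgeConjecture.HodgeConjecture.Theorems
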